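import Summits.AtomisticToContinuum.Crystallization.Theorems.ThreeConeCertificateSlackRigidityLayeringStar

/-!
# Line `c-layer-witness-strictness` (crux `SlackRigidity`, stmt-AtomisticToContinuum-11960):
# layering off the ideal ratio — part 3/4, the local structure lemma and the layers

Stub `stub_layeringOffIdeal`, part 3.  LOCAL STRUCTURE LEMMA (`std_of_two_neighbours`): if the
recentred `6a/5`-star of `p ∈ Y` is a linearly rotated standard star and two ADJACENT hexagon
vectors `e₁, e₂` have `p + e₁, p + e₂ ∈ Y`, then the star of `p` IS a standard star
`{0} ∪ H ∪ (h e₃ + τ₁ T) ∪ (−h e₃ + τ₂ T)` (the rotation fixes the hexagon setwise by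
`layeringHex_eq_of_adjacent`, hence `e₃ ↦ ±e₃` and hole classes go to hole classes by
`holes_of_adjacent`).  IN-LAYER PROPAGATION (`layer_subset_of_two_neighbours`, induction over
`ℤ²`), NEXT LAYER (`exists_next_layer_of_layer`: a full layer forces a full layer on each side,
in position `σ w`, `σ = ±1`) and ALL LAYERS (`layeringLayers_exists_barlowStacking_subset`: two
`ℕ`-recursions as in `Literature/Geometry/DiscreteGeometry/LayerStackings.lean`) follow.
All `[folklore]` (Hales, *Dense Sphere Packings* §1.3, run at general `(a, h)` with exact stars).
-/
noncomputable section

namespace Summit.AtomisticToContinuum.Crystallization.Theorems.CLayerWitnessLayering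

open Literature.MathematicalPhysics.StatisticalMechanics RealInnerProductSpace

/-- Euclidean `3`-space. -/
local notation "E3" => EuclideanSpace ℝ (Fin 3)
set_option hygiene false in
/-- First in-layer generator `u = (a, 0, 0)` (the ambient `a`). -/
local notation "𝐮" => triangularVec₁ a
set_option hygiene false in
/-- Second in-layer generator `v = (a/2, a√3/2, 0)`. -/
local notation "𝐯" => triangularVec₂ a
set_option hygiene false in
/-- The hole offset `w = (u + v)/3`. -/
local notation "𝐰" => barlowOffset a
set_option hygiene false in
/-- The interlayer vector `h e₃` (the ambient `h`). -/
local notation "𝐞" => layerNormal h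
set_option hygiene false in
/-- The standard hexagon `H = {u, v, −u, −v, u − v, v − u}`. -/
local notation "Hex" => ({triangularVec₁ a, triangularVec₂ a, -triangularVec₁ a, -triangularVec₂ a,
    triangularVec₁ a - triangularVec₂ a, triangularVec₂ a - triangularVec₁ a} :
      Set (EuclideanSpace ℝ (Fin 3)))
set_option hygiene false in
/-- The hole points `{w, w − u, w − v}` of class `+1`. -/
local notation "Holes" => ({barlowOffset a, barlowOffset a - triangularVec₁ a,
    barlowOffset a - triangularVec₂ a} : Set (EuclideanSpace ℝ (Fin 3)))
set_option hygiene false in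
/-- The lifted signed hole triple `h e₃ + τ {w, w − u, w − v}`. -/
local notation "Up[" τ "]" => ({layerNormal h + τ • barlowOffset a,
    layerNormal h + τ • (barlowOffset a - triangularVec₁ a),
    layerNormal h + τ • (barlowOffset a - triangularVec₂ a)} : Set (EuclideanSpace ℝ (Fin 3)))
set_option hygiene false in
/-- The lowered signed hole triple `−h e₃ + τ {w, w − u, w − v}`. -/
local notation "Dn[" τ "]" => ({-layerNormal h + τ • barlowOffset a,
    -layerNormal h + τ • (barlowOffset a - triangularVec₁ a),
    -layerNormal h + τ • (barlowOffset a - triangularVec₂ a)} : Set (EuclideanSpace ℝ (Fin 3)))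
set_option hygiene false in
/-- The standard 13-point star with upper class `σ` and lower class `τ`. -/
local notation "Std[" σ ", " τ "]" =>
  (({0} : Set (EuclideanSpace ℝ (Fin 3))) ∪ Hex ∪ Up[σ] ∪ Dn[τ])

variable {a h : ℝ}

/-! ## The local structure lemma -/
/-- Products of signs are signs. [folklore] -/
theorem sign_mul_sign {σ τ : ℝ} (hσ : σ = 1 ∨ σ = -1) (hτ : τ = 1 ∨ τ = -1) :
    σ * τ = 1 ∨ σ * τ = -1 := by
  rcases hσ with rfl | rfl <;> rcases hτ with rfl | rfl <;> norm_num
/-- **Local structure lemma.** Window + off-ideal; the recentred `6a/5`-star of `p` is a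
linearly rotated standard star; two adjacent hexagon vectors `e₁, e₂` have `p + e₁, p + e₂ ∈ Y`.
Then the star of `p` is a standard star `{0} ∪ H ∪ (h e₃ + τ₁ T) ∪ (−h e₃ + τ₂ T)`. [folklore] -/
theorem std_of_two_neighbours (ha : 0 < a) (hh : 0 < h) (hw1 : 0.775 * a < h)
    (hw2 : h < 0.894 * a) (hoff : h ^ 2 ≠ 2 * a ^ 2 / 3) {Y : Set E3} {p : E3} {s : ℤ → ℤ}
    (hs : IsHaggSeq s) {B : E3 →ₗᵢ[ℝ] E3}
    (hstar : ((fun z => z - p) '' Y) ∩ Metric.closedBall 0 (6 * a / 5) =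
      B '' (barlowStacking a h s ∩ Metric.closedBall 0 (6 * a / 5)))
    {e₁ e₂ : E3} (he₁ : e₁ ∈ Hex) (he₂ : e₂ ∈ Hex) (hd : dist e₁ e₂ = a)
    (hY₁ : p + e₁ ∈ Y) (hY₂ : p + e₂ ∈ Y) :
    ∃ τ₁ τ₂ : ℝ, (τ₁ = 1 ∨ τ₁ = -1) ∧ (τ₂ = 1 ∨ τ₂ = -1) ∧
      ((fun z => z - p) '' Y) ∩ Metric.closedBall 0 (6 * a / 5) = Std[τ₁, τ₂] := by
  rw [layeringStar_stacking_inter_closedBall ha hh hw1 hw2 hs] at hstar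
  set σ₁ : ℝ := ((s 0 : ℤ) : ℝ) with hσ₁_def
  set σ₂ : ℝ := -((s (-1) : ℤ) : ℝ) with hσ₂_def
  have hσ₁ : σ₁ = 1 ∨ σ₁ = -1 := by rcases hs 0 with h0 | h0 <;> simp [hσ₁_def, h0]
  have hσ₂ : σ₂ = 1 ∨ σ₂ = -1 := by rcases hs (-1) with h0 | h0 <;> simp [hσ₂_def, h0]
  -- the two neighbours are norm-`a` points of the star, hence images of hexagon points
  have hmem : ∀ e ∈ Hex, p + e ∈ Y → ∃ f ∈ Hex, B f = e := by
    intro e he hY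
    have h1 : e ∈ ((fun z => z - p) '' Y) ∩ Metric.closedBall 0 (6 * a / 5) := by
      refine ⟨⟨p + e, hY, by abel⟩, ?_⟩
      rw [Metric.mem_closedBall, dist_zero_right, norm_of_mem_hex ha.le he]
      linarith
    rw [hstar] at h1
    obtain ⟨f, hf, hfe⟩ := h1
    refine ⟨f, mem_hex_of_mem_std ha hoff hσ₁ hσ₂ hf ?_, hfe⟩
    rw [← B.norm_map, hfe, norm_of_mem_hex ha.le he]
  obtain ⟨f₁, hf₁, hfe₁⟩ := hmem e₁ he₁ hY₁
  obtain ⟨f₂, hf₂, hfe₂⟩ := hmem e₂ he₂ hY₂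
  have hdf : dist f₁ f₂ = a := by rw [← B.dist_map, hfe₁, hfe₂, hd]
  -- hence `B` maps the hexagon onto itself
  have hBH : B '' Hex = Hex := by
    conv_lhs => rw [layeringHex_eq_of_adjacent ha hf₁ hf₂ hdf]
    rw [layeringHex_eq_of_adjacent ha he₁ he₂ hd]
    simp only [Set.image_insert_eq, Set.image_singleton, map_neg, map_sub, hfe₁, hfe₂]
  have hBu : B 𝐮 ∈ Hex := hBH.subset ⟨_, vecU_mem_hex, rfl⟩
  have hBv : B 𝐯 ∈ Hex := hBH.subset ⟨_, vecV_mem_hex, rfl⟩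
  have hduv : dist (B 𝐮) (B 𝐯) = a := by rw [B.dist_map]; exact dist_vecU_vecV ha.le
  -- and each hole class onto a hole class
  obtain ⟨τ, hτ, hholes⟩ := holes_of_adjacent ha hBu hBv hduv
  have hBw : B 𝐰 = (1 / 3 : ℝ) • (B 𝐮 + B 𝐯) := by rw [vecW_eq, map_smul, map_add]
  have hBT : B '' Holes = {τ • 𝐰, τ • (𝐰 - 𝐮), τ • (𝐰 - 𝐯)} := by
    rw [← hholes]; simp only [Set.image_insert_eq, Set.image_singleton, map_sub, hBw]
  -- and `e₃` to `± e₃`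
  have hBe : B 𝐞 = 𝐞 ∨ B 𝐞 = -𝐞 := by
    apply eq_vecE_or_of_inner ha hh
    · obtain ⟨f, hf, hfu⟩ := hBH.symm.subset vecU_mem_hex
      rw [← hfu, B.inner_map_map]; exact inner_vecE_of_mem_hex hf
    · obtain ⟨f, hf, hfv⟩ := hBH.symm.subset vecV_mem_hex
      rw [← hfv, B.inner_map_map]; exact inner_vecE_of_mem_hex hf
    · rw [B.inner_map_map, inner_ee]
  -- images of the two triples
  have hUp : ∀ σ : ℝ, B '' Up[σ] =
      {B 𝐞 + (σ * τ) • 𝐰, B 𝐞 + (σ * τ) • (𝐰 - 𝐮), B 𝐞 + (σ * τ) • (𝐰 - 𝐯)} := by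
    intro σ
    calc B '' Up[σ] = (fun y => B 𝐞 + σ • y) '' (B '' Holes) := by
          simp only [Set.image_insert_eq, Set.image_singleton, map_add, map_smul, map_sub]
      _ = _ := by rw [hBT]; simp only [Set.image_insert_eq, Set.image_singleton, smul_smul]
  have hDn : ∀ σ : ℝ, B '' Dn[σ] =
      {-B 𝐞 + (σ * τ) • 𝐰, -B 𝐞 + (σ * τ) • (𝐰 - 𝐮), -B 𝐞 + (σ * τ) • (𝐰 - 𝐯)} := by
    intro σ
    calc B '' Dn[σ] = (fun y => -B 𝐞 + σ • y) '' (B '' Holes) := by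
          simp only [Set.image_insert_eq, Set.image_singleton, map_add, map_smul, map_sub,
            map_neg]
      _ = _ := by rw [hBT]; simp only [Set.image_insert_eq, Set.image_singleton, smul_smul]
  rw [hstar]
  simp only [Set.image_union, Set.image_singleton, map_zero, hBH, hUp, hDn]
  rcases hBe with hBe | hBe
  · refine ⟨σ₁ * τ, σ₂ * τ, sign_mul_sign hσ₁ hτ, sign_mul_sign hσ₂ hτ, ?_⟩
    rw [hBe]
  · refine ⟨σ₂ * τ, σ₁ * τ, sign_mul_sign hσ₂ hτ, sign_mul_sign hσ₁ hτ, ?_⟩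
    rw [hBe, neg_neg, Set.union_right_comm]

/-! ## In-layer propagation -/
/-- Under the star hypothesis, a point of `Y` with two adjacent hexagon neighbours in `Y` has
its whole standard hexagon in `Y`. [folklore] -/
theorem hex_neighbours_mem (ha : 0 < a) (hh : 0 < h) (hw1 : 0.775 * a < h)
    (hw2 : h < 0.894 * a) (hoff : h ^ 2 ≠ 2 * a ^ 2 / 3) {Y : Set E3}
    (hloc : ∀ y ∈ Y, ∃ s : ℤ → ℤ, IsHaggSeq s ∧ ∃ B : E3 →ₗᵢ[ℝ] E3,
      ((fun z => z - y) '' Y) ∩ Metric.closedBall 0 (6 * a / 5) =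
        B '' (barlowStacking a h s ∩ Metric.closedBall 0 (6 * a / 5)))
    {p : E3} (hp : p ∈ Y) {e₁ e₂ : E3} (he₁ : e₁ ∈ Hex) (he₂ : e₂ ∈ Hex) (hd : dist e₁ e₂ = a)
    (hY₁ : p + e₁ ∈ Y) (hY₂ : p + e₂ ∈ Y) : ∀ e ∈ Hex, p + e ∈ Y := by
  obtain ⟨s, hs, B, hstar⟩ := hloc p hp
  obtain ⟨τ₁, τ₂, -, -, hstd⟩ :=
    std_of_two_neighbours ha hh hw1 hw2 hoff hs hstar he₁ he₂ hd hY₁ hY₂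
  intro e he
  have h1 : e ∈ ((fun z => z - p) '' Y) ∩ Metric.closedBall 0 (6 * a / 5) := by
    rw [hstd]; simp only [Set.mem_union]; exact Or.inl (Or.inl (Or.inr he))
  obtain ⟨⟨y, hy, hye⟩, -⟩ := h1
  simp only at hye
  have h2 : p + e = y := by rw [← hye]; abel
  rw [h2]; exact hy
/-- **In-layer propagation**: under the star hypothesis, a point `p ∈ Y` with two adjacent
hexagon neighbours in `Y` has its whole triangular layer `p + ℤu + ℤv` in `Y` (induction over
`ℤ²`, the local structure lemma at every step). [folklore] -/
theorem layer_subset_of_two_neighbours (ha : 0 < a) (hh : 0 < h) (hw1 : 0.775 * a < h)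
    (hw2 : h < 0.894 * a) (hoff : h ^ 2 ≠ 2 * a ^ 2 / 3) {Y : Set E3}
    (hloc : ∀ y ∈ Y, ∃ s : ℤ → ℤ, IsHaggSeq s ∧ ∃ B : E3 →ₗᵢ[ℝ] E3,
      ((fun z => z - y) '' Y) ∩ Metric.closedBall 0 (6 * a / 5) =
        B '' (barlowStacking a h s ∩ Metric.closedBall 0 (6 * a / 5)))
    {p : E3} (hp : p ∈ Y) {e₁ e₂ : E3} (he₁ : e₁ ∈ Hex) (he₂ : e₂ ∈ Hex) (hd : dist e₁ e₂ = a)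
    (hY₁ : p + e₁ ∈ Y) (hY₂ : p + e₂ ∈ Y) :
    ∀ i j : ℤ, p + (i : ℝ) • 𝐮 + (j : ℝ) • 𝐯 ∈ Y := by
  have key : ∀ q : E3, q ∈ Y → ∀ f₁ ∈ Hex, ∀ f₂ ∈ Hex, dist f₁ f₂ = a → q + f₁ ∈ Y →
      q + f₂ ∈ Y → ∀ e ∈ Hex, q + e ∈ Y :=
    fun q hq f₁ hf₁ f₂ hf₂ hdf h₁ h₂ =>
      hex_neighbours_mem ha hh hw1 hw2 hoff hloc hq hf₁ hf₂ hdf h₁ h₂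
  let P : ℤ → ℤ → Prop := fun i j =>
    p + (i : ℝ) • 𝐮 + (j : ℝ) • 𝐯 ∈ Y ∧ ∀ e ∈ Hex, p + (i : ℝ) • 𝐮 + (j : ℝ) • 𝐯 + e ∈ Y
  have huv : dist (𝐮 : E3) 𝐯 = a := dist_vecU_vecV ha.le
  have hvu : dist (𝐯 : E3) 𝐮 = a := by rw [dist_comm]; exact huv
  have hnuv : dist (-𝐮 : E3) (-𝐯) = a := dist_neg_vecU_neg_vecV ha.le
  have hnvu : dist (-𝐯 : E3) (-𝐮) = a := by rw [dist_comm]; exact hnuv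
  have h00 : P 0 0 := by
    have e0 : p + ((0 : ℤ) : ℝ) • (𝐮 : E3) + ((0 : ℤ) : ℝ) • 𝐯 = p := by push_cast; module
    refine ⟨by rw [e0]; exact hp, fun e he => ?_⟩
    rw [e0]; exact key p hp e₁ he₁ e₂ he₂ hd hY₁ hY₂ e he
  have hsi : ∀ i j, P i j → P (i + 1) j := by
    rintro i j ⟨hq, hqH⟩
    have e1 : p + ((i + 1 : ℤ) : ℝ) • (𝐮 : E3) + (j : ℝ) • 𝐯 =
        p + (i : ℝ) • 𝐮 + (j : ℝ) • 𝐯 + 𝐮 := by push_cast; module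
    have hq' : p + ((i + 1 : ℤ) : ℝ) • (𝐮 : E3) + (j : ℝ) • 𝐯 ∈ Y := e1 ▸ hqH _ vecU_mem_hex
    refine ⟨hq', key _ hq' _ neg_vecU_mem_hex _ neg_vecV_mem_hex hnuv ?_ ?_⟩
    · convert hq using 1; push_cast; module
    · convert hqH (𝐮 - 𝐯) (by simp) using 1; push_cast; module
  have hpi : ∀ i j, P i j → P (i - 1) j := by
    rintro i j ⟨hq, hqH⟩
    have e1 : p + ((i - 1 : ℤ) : ℝ) • (𝐮 : E3) + (j : ℝ) • 𝐯 =
        p + (i : ℝ) • 𝐮 + (j : ℝ) • 𝐯 + -𝐮 := by push_cast; module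
    have hq' : p + ((i - 1 : ℤ) : ℝ) • (𝐮 : E3) + (j : ℝ) • 𝐯 ∈ Y := e1 ▸ hqH _ neg_vecU_mem_hex
    refine ⟨hq', key _ hq' _ vecU_mem_hex _ vecV_mem_hex huv ?_ ?_⟩
    · convert hq using 1; push_cast; module
    · convert hqH (𝐯 - 𝐮) (by simp) using 1; push_cast; module
  have hsj : ∀ i j, P i j → P i (j + 1) := by
    rintro i j ⟨hq, hqH⟩
    have e1 : p + (i : ℝ) • (𝐮 : E3) + ((j + 1 : ℤ) : ℝ) • 𝐯 =
        p + (i : ℝ) • 𝐮 + (j : ℝ) • 𝐯 + 𝐯 := by push_cast; module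
    have hq' : p + (i : ℝ) • (𝐮 : E3) + ((j + 1 : ℤ) : ℝ) • 𝐯 ∈ Y := e1 ▸ hqH _ vecV_mem_hex
    refine ⟨hq', key _ hq' _ neg_vecV_mem_hex _ neg_vecU_mem_hex hnvu ?_ ?_⟩
    · convert hq using 1; push_cast; module
    · convert hqH (𝐯 - 𝐮) (by simp) using 1; push_cast; module
  have hpj : ∀ i j, P i j → P i (j - 1) := by
    rintro i j ⟨hq, hqH⟩
    have e1 : p + (i : ℝ) • (𝐮 : E3) + ((j - 1 : ℤ) : ℝ) • 𝐯 =
        p + (i : ℝ) • 𝐮 + (j : ℝ) • 𝐯 + -𝐯 := by push_cast; module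
    have hq' : p + (i : ℝ) • (𝐮 : E3) + ((j - 1 : ℤ) : ℝ) • 𝐯 ∈ Y := e1 ▸ hqH _ neg_vecV_mem_hex
    refine ⟨hq', key _ hq' _ vecV_mem_hex _ vecU_mem_hex hvu ?_ ?_⟩
    · convert hq using 1; push_cast; module
    · convert hqH (𝐮 - 𝐯) (by simp) using 1; push_cast; module
  have hi0 : ∀ i, P i 0 := fun i =>
    Int.induction_on i h00 (fun i ih => hsi _ _ ih) (fun i ih => hpi _ _ ih)
  exact fun i j =>
    (Int.induction_on j (hi0 i) (fun j ih => hsj _ _ ih) (fun j ih => hpj _ _ ih) : P i j).1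

/-! ## The next layer -/

/-- Reading a point of `Y` off an identified star. [folklore] -/
theorem add_mem_of_star_eq {Y : Set E3} {p x : E3} {S : Set E3}
    (hS : ((fun z => z - p) '' Y) ∩ Metric.closedBall 0 (6 * a / 5) = S) (hx : x ∈ S) :
    p + x ∈ Y := by
  have h1 : x ∈ ((fun z => z - p) '' Y) ∩ Metric.closedBall 0 (6 * a / 5) := by rw [hS]; exact hx
  obtain ⟨⟨y, hy, hye⟩, -⟩ := h1
  simp only at hye
  have h2 : p + x = y := by rw [← hye]; abel
  rw [h2]; exact hy

/-- **One layer forces the next**: under the star hypothesis, a full triangular layer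
`c + ℤu + ℤv ⊆ Y` forces on each side `t = ±1` a full layer `c + σ w + t h e₃ + ℤu + ℤv ⊆ Y` for
one sign `σ` (position `B` or `C`). [folklore] -/
theorem exists_next_layer_of_layer (ha : 0 < a) (hh : 0 < h) (hw1 : 0.775 * a < h)
    (hw2 : h < 0.894 * a) (hoff : h ^ 2 ≠ 2 * a ^ 2 / 3) {Y : Set E3}
    (hloc : ∀ y ∈ Y, ∃ s : ℤ → ℤ, IsHaggSeq s ∧ ∃ B : E3 →ₗᵢ[ℝ] E3,
      ((fun z => z - y) '' Y) ∩ Metric.closedBall 0 (6 * a / 5) =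
        B '' (barlowStacking a h s ∩ Metric.closedBall 0 (6 * a / 5)))
    {c : E3} (hc : ∀ i j : ℤ, c + (i : ℝ) • 𝐮 + (j : ℝ) • 𝐯 ∈ Y) {t : ℝ} (ht : t = 1 ∨ t = -1) :
    ∃ σ : ℝ, (σ = 1 ∨ σ = -1) ∧
      ∀ i j : ℤ, (c + σ • 𝐰 + t • 𝐞) + (i : ℝ) • 𝐮 + (j : ℝ) • 𝐯 ∈ Y := by
  have hc0 : c ∈ Y := by simpa using hc 0 0
  have hcu : c + 𝐮 ∈ Y := by simpa using hc 1 0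
  have hcv : c + 𝐯 ∈ Y := by simpa using hc 0 1
  obtain ⟨s, hs, B, hstar⟩ := hloc c hc0
  obtain ⟨τ₁, τ₂, hτ₁, hτ₂, hstd⟩ := std_of_two_neighbours ha hh hw1 hw2 hoff hs hstar
    vecU_mem_hex vecV_mem_hex (dist_vecU_vecV ha.le) hcu hcv
  have hsmem : ∀ {σ : ℝ}, (σ = 1 ∨ σ = -1) → -(σ • (𝐮 : E3)) ∈ Hex ∧ -(σ • (𝐯 : E3)) ∈ Hex ∧
      dist (-(σ • (𝐮 : E3))) (-(σ • 𝐯)) = a := by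
    rintro σ (rfl | rfl)
    · refine ⟨by simp, by simp, ?_⟩
      rw [dist_neg_neg, one_smul, one_smul]; exact dist_vecU_vecV ha.le
    · refine ⟨by simp, by simp, ?_⟩
      rw [dist_neg_neg, neg_one_smul, neg_one_smul, dist_neg_neg]; exact dist_vecU_vecV ha.le
  rcases ht with rfl | rfl
  · obtain ⟨h1, h2, h3⟩ := hsmem hτ₁
    refine ⟨τ₁, hτ₁, layer_subset_of_two_neighbours ha hh hw1 hw2 hoff hloc ?_ h1 h2 h3 ?_ ?_⟩
    · convert add_mem_of_star_eq hstd (x := 𝐞 + τ₁ • 𝐰)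
        (Or.inl (Or.inr (Set.mem_insert _ _))) using 1; module
    · convert add_mem_of_star_eq hstd (x := 𝐞 + τ₁ • (𝐰 - 𝐮))
        (Or.inl (Or.inr (Set.mem_insert_of_mem _ (Set.mem_insert _ _)))) using 1; module
    · convert add_mem_of_star_eq hstd (x := 𝐞 + τ₁ • (𝐰 - 𝐯))
        (Or.inl (Or.inr (Set.mem_insert_of_mem _ (Set.mem_insert_of_mem _ rfl)))) using 1; module
  · obtain ⟨h1, h2, h3⟩ := hsmem hτ₂
    refine ⟨τ₂, hτ₂, layer_subset_of_two_neighbours ha hh hw1 hw2 hoff hloc ?_ h1 h2 h3 ?_ ?_⟩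
    · convert add_mem_of_star_eq hstd (x := -𝐞 + τ₂ • 𝐰)
        (Or.inr (Set.mem_insert _ _)) using 1; module
    · convert add_mem_of_star_eq hstd (x := -𝐞 + τ₂ • (𝐰 - 𝐮))
        (Or.inr (Set.mem_insert_of_mem _ (Set.mem_insert _ _))) using 1; module
    · convert add_mem_of_star_eq hstd (x := -𝐞 + τ₂ • (𝐰 - 𝐯))
        (Or.inr (Set.mem_insert_of_mem _ (Set.mem_insert_of_mem _ rfl))) using 1; module

/-! ## All the layers -/

/-- **All the layers.** Under the star hypothesis, from the full layer `ℤu + ℤv ⊆ Y`, iterating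
`exists_next_layer_of_layer` upwards and downwards gives full layers at all heights `k h`,
`k ∈ ℤ`, in positions `(haggLabel s k) w` for a Hägg sequence `s`, i.e.
`barlowStacking a h s ⊆ Y` (the recursion of `LayerStackings.exists_barlowStacking_subset`).
[folklore] -/
theorem layeringLayers_exists_barlowStacking_subset (ha : 0 < a) (hh : 0 < h) (hw1 : 0.775 * a < h)
    (hw2 : h < 0.894 * a) (hoff : h ^ 2 ≠ 2 * a ^ 2 / 3) {Y : Set E3}
    (hloc : ∀ y ∈ Y, ∃ s : ℤ → ℤ, IsHaggSeq s ∧ ∃ B : E3 →ₗᵢ[ℝ] E3,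
      ((fun z => z - y) '' Y) ∩ Metric.closedBall 0 (6 * a / 5) =
        B '' (barlowStacking a h s ∩ Metric.closedBall 0 (6 * a / 5)))
    (h0 : ∀ i j : ℤ, (i : ℝ) • (𝐮 : E3) + (j : ℝ) • 𝐯 ∈ Y) :
    ∃ s : ℤ → ℤ, IsHaggSeq s ∧ barlowStacking a h s ⊆ Y := by
  classical
  -- the layer predicate and the next sign
  let Lay : E3 → Prop := fun c => ∀ i j : ℤ, c + (i : ℝ) • (𝐮 : E3) + (j : ℝ) • 𝐯 ∈ Y
  let next : E3 → ℝ → ℤ := fun c t => if Lay (c + 𝐰 + t • 𝐞) then 1 else -1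
  have next_spec : ∀ (c : E3) (t : ℝ), Lay c → (t = 1 ∨ t = -1) →
      (next c t = 1 ∨ next c t = -1) ∧ Lay (c + (next c t : ℝ) • 𝐰 + t • 𝐞) := by
    intro c t hc ht
    obtain ⟨σ, hσ, hlay⟩ := exists_next_layer_of_layer ha hh hw1 hw2 hoff hloc hc ht
    by_cases hL : Lay (c + 𝐰 + t • 𝐞)
    · have hn : next c t = 1 := if_pos hL
      refine ⟨Or.inl hn, ?_⟩
      rw [hn]; simpa using hL
    · have hn : next c t = -1 := if_neg hL
      refine ⟨Or.inr hn, ?_⟩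
      rcases hσ with rfl | rfl
      · exact absurd (by simpa using hlay) hL
      · rw [hn]; simpa using hlay
  -- the bases of the layers, upwards (`t = 1`) and downwards (`t = -1`)
  let base : ℝ → ℕ → E3 := fun t n =>
    Nat.rec (motive := fun _ => E3) 0 (fun _ b => b + (next b t : ℝ) • 𝐰 + t • 𝐞) n
  have base_zero : ∀ t, base t 0 = 0 := fun t => rfl
  have base_succ : ∀ t n, base t (n + 1) = base t n + (next (base t n) t : ℝ) • 𝐰 + t • 𝐞 :=
    fun t n => rfl
  have hLay0 : Lay 0 := fun i j => by simpa using h0 i j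
  have base_spec : ∀ t, (t = 1 ∨ t = -1) → ∀ n, Lay (base t n) ∧
      (next (base t n) t = 1 ∨ next (base t n) t = -1) := by
    intro t ht n
    induction n with
    | zero => exact ⟨hLay0, (next_spec 0 t hLay0 ht).1⟩
    | succ n ih =>
      have h1 := (next_spec _ t ih.1 ht).2
      rw [← base_succ] at h1
      exact ⟨h1, (next_spec _ t h1 ht).1⟩
  -- the Hägg sequence
  let sq : ℤ → ℤ := fun k =>
    if 0 ≤ k then next (base 1 k.toNat) 1 else -next (base (-1) (-k - 1).toNat) (-1)
  have hsq : IsHaggSeq sq := by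
    intro k
    by_cases hk : 0 ≤ k
    · simp only [sq, if_pos hk]
      exact (base_spec 1 (Or.inl rfl) _).2
    · simp only [sq, if_neg hk]
      rcases (base_spec (-1) (Or.inr rfl) (-k - 1).toNat).2 with h | h <;> rw [h] <;> norm_num
  have sq_nat : ∀ n : ℕ, sq n = next (base 1 n) 1 := fun n => by
    simp only [sq, if_pos (Int.natCast_nonneg n), Int.toNat_natCast]
  have sq_neg : ∀ n : ℕ, sq (-((n : ℤ) + 1)) = -next (base (-1) n) (-1) := fun n => by
    have h1 : ¬ (0 : ℤ) ≤ -((n : ℤ) + 1) := by omega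
    have h2 : (-(-((n : ℤ) + 1)) - 1).toNat = n := by simp
    simp only [sq, if_neg h1, h2]
  -- the layer bases are those of the Barlow stacking of `sq`
  have up : ∀ n : ℕ, base 1 n = (haggLabel sq n : ℝ) • 𝐰 + ((n : ℤ) : ℝ) • 𝐞 := by
    intro n
    induction n with
    | zero => simp [base_zero]
    | succ n ih =>
      rw [base_succ]
      set ν := next (base 1 n) 1 with hν
      rw [ih, Nat.cast_succ, haggLabel_succ, sq_nat n, ← hν]
      push_cast
      module
  have down : ∀ n : ℕ, base (-1) n =
      (haggLabel sq (-(n : ℤ)) : ℝ) • 𝐰 + ((-(n : ℤ) : ℤ) : ℝ) • 𝐞 := by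
    intro n
    induction n with
    | zero => simp [base_zero]
    | succ n ih =>
      have hrec : haggLabel sq (-(n : ℤ)) =
          haggLabel sq (-((n : ℤ) + 1)) + sq (-((n : ℤ) + 1)) := by
        have := haggLabel_succ sq (-((n : ℤ) + 1))
        rwa [show -((n : ℤ) + 1) + 1 = -(n : ℤ) by ring] at this
      rw [base_succ]
      set ν := next (base (-1) n) (-1) with hν
      rw [ih]
      have e : (haggLabel sq (-((n + 1 : ℕ) : ℤ)) : ℝ) = haggLabel sq (-(n : ℤ)) + ν := by
        rw [Nat.cast_succ, hrec, sq_neg n, ← hν]; push_cast; ring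
      rw [e]
      push_cast
      module
  refine ⟨sq, hsq, ?_⟩
  rintro x ⟨k, i, j, rfl⟩
  rcases le_or_gt 0 k with hk | hk
  · lift k to ℕ using hk
    have h1 := (base_spec 1 (Or.inl rfl) k).1 i j
    rw [up k] at h1
    convert h1 using 1
    simp only [barlowPos]; push_cast; module
  · obtain ⟨n, rfl⟩ : ∃ n : ℕ, k = -((n : ℤ) + 1) := ⟨(-k - 1).toNat, by omega⟩
    have h1 := (base_spec (-1) (Or.inr rfl) (n + 1)).1 i j
    rw [down (n + 1)] at h1
    convert h1 using 1
    simp only [barlowPos]; push_cast; module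


/-- Registered sub-goal form of `layeringLayers_exists_barlowStacking_subset`. [folklore] -/
theorem layeringLayers_stacking_subset :
    ∀ {a h : ℝ}, 0 < a → 0 < h → 0.775 * a < h → h < 0.894 * a → h ^ 2 ≠ 2 * a ^ 2 / 3 →
      ∀ {Y : Set (EuclideanSpace ℝ (Fin 3))}, (∀ y ∈ Y, ∃ s : ℤ → ℤ, IsHaggSeq s ∧
        ∃ B : EuclideanSpace ℝ (Fin 3) →ₗᵢ[ℝ] EuclideanSpace ℝ (Fin 3),
          ((fun z => z - y) '' Y) ∩ Metric.closedBall 0 (6 * a / 5) =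
            B '' (barlowStacking a h s ∩ Metric.closedBall 0 (6 * a / 5))) →
      (∀ i j : ℤ, (i : ℝ) • (triangularVec₁ a : EuclideanSpace ℝ (Fin 3)) +
        (j : ℝ) • triangularVec₂ a ∈ Y) → ∃ s : ℤ → ℤ, IsHaggSeq s ∧ barlowStacking a h s ⊆ Y :=
  fun ha hh hw1 hw2 hoff _ hloc h0 => layeringLayers_exists_barlowStacking_subset ha hh hw1 hw2 hoff hloc h0

end Summit.AtomisticToContinuum.Crystallization.Theorems.CLayerWitnessLayering

end
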